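import Summits.QuantumFields.YangMills.Theorems.BalabanUVNodesK1RunwiseLettersOfBoxH
import Summits.QuantumFields.YangMills.Theorems.BalabanUVNodesK2NamedJetsRunRemAt
import Literature.MathematicalPhysics.QuantumFieldTheory.Balaban1983to89.Node00.Record13SClassSepCoPHG

/-!
# K1 — RUN-WISE LETTERS FROM β-BOXES, CONE-SIDE COMPANION: the two residue-shaped drop-ins that need DEF-1's `RunConstRemainder` token ∕ node00's S- and G-class record vocabulary
# (`runConstRemainder_zero_of_boxH` in the token; the S-∕G-class `FlowStepPrinted` leaf in BOX currency) as ONE-LINE INSTANCES of the seam-independent core `…K1RunwiseLettersOfBoxH`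

Cell `pub-ymgap`, width seat `pub-ymgap-dag-n07-w3` (g17; N07 [B11] ∕ K0⁷–K1 junction).  `--kind proof --supports stmt-QuantumFields-27364 --as helper`, COUNT-NEUTRAL.  NEW leaf;
theorems only — 0 `def`, 0 `sorry`, 0 `instance`, 0 `notation`.  RESIDUE-FREE (none of node00-def-R's residue_v6 modules in the closure) but ON THE SEAM's CONE through
`Thm/…K2NamedJetsRunRemAt` (`RunConstRemainder`) and `Node00/Record13SClassSepCoPHG` (⇒ `…SClassSepCoPH`: `IsRecordOfRecord₁₃CSepCoPH{S,G}`, `construction_eq_…`, `rgFlow_of_smallCouplings_…`) —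
stale while the Stage-2 campaign rebuilds, green after it.  The seam-independent statements live in `…K1RunwiseLettersOfBoxH` (this seat, CLAIM-1); this companion only re-points names for
dag-n24-c g20's item (b) (CLASS-S editions of `…AtAbstractWitness(Y0)`: «pure import ∕ name re-point», bus 2026-08-30 I.18807).  [I] = [Balaban1987RG1]; [III] = [Balaban1988Convergent];
[II′] = [Balaban1989LargeFieldII].

CONTENTS.  §1 `runConstRemainder_zero_of_boxH'` — drop-in for `…PSFloorWorldBuilt.runConstRemainder_zero_of_boxH` (`RunConstRemainder β (fun _ ↦ 0) (max β′ (−bₗ)) γ₀` from the box at a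
level `γ ≥ γ₀`), `runConstRemainder_mid_of_boxH'` (DEF-1's token on the core's sharp recentred remainder), `runConstRemainder_zero_of_absBoxH'`; §2 `flowStepPrinted_leavesP_of_betaUpperH_noShrinkS` ∕
`…G` — the S-∕G-class DAG leaf in BOX currency (the core's CLASS-FREE `flowStepPrinted_leavesP_of_runLetters` at `β := D.βfun`, `hcur := D.curries`, `w.C = D.C`, `rgFlow` from the class; the
residue CEILING-currency sentences `flowStepPrinted_leavesP_of_ceiling_noShrink(G)` are NOT restated — the gate's `dedup.landed` indexes them (dry-run 2026-08-30 14:40Z) — their green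
one-liner is given in the docstrings) and `curriesHBeta_world_of_construction_eq` (the one extra argument).

HONEST FRAMING (binding).  Name re-points of elementary bookkeeping; NO β estimate — boxes ∕ ceilings ∕ no-shrink letters are DISPLAYED HYPOTHESES (NODE O's wall: [I] §1 p.264 «uniformly
bounded» stated, proof unpublished, [II′] p.355); nothing of Bałaban's asserted; K0⁷ (stmt-QuantumFields-20541) ∕ K1⁹ (27364) ∕ K3⁸ (27366) NOT closed; N07 ∕ N24 NOT discharged; counts
UNMOVED (typed 28∕28 · discharged 8∕28, route display 8∕27 excl. NODE O; K 1∕4 — the chair's words); R4 = the CONDITIONAL finite-𝕋⁴ rung `BalabanLadder.UV` at fixed `ε = L^(−K)` only —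
NOT continuum ∕ ℝ⁴ ∕ OS; the Yang–Mills mass gap (Clay) is NOT proved by any of this.  Standard axioms only.
-/

noncomputable section

open scoped Matrix.Norms.L2Operator

namespace Summit.QuantumFields.YangMills.Theorems.K1RunwiseLettersOfBoxHAtRecord

open Literature.MathematicalPhysics.QuantumFieldTheory.Balaban1983to89
open Literature.MathematicalPhysics.QuantumFieldTheory.Balaban1983to89.Node00
open Literature.MathematicalPhysics.QuantumFieldTheory.Balaban1983to89.T4Continuum
open Literature.MathematicalPhysics.QuantumFieldTheory.Balaban1983to89.FlowStep
open Literature.MathematicalPhysics.QuantumFieldTheory.Balaban1983to89.DagBinding (WorldP leavesP CurriesHBeta)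
open Summit.QuantumFields.YangMills.Theorems.BalabanUVNodesK2NamedJetsRunRemAt (RunConstRemainder)
open Summit.QuantumFields.YangMills.Theorems.K1RunwiseLettersOfBoxH (runTwoSided_of_boxH runMidRemainder_of_boxH runAbs_of_absBoxH flowStepPrinted_leavesP_of_runLetters)

/-! ## §1  DEF-1's `RunConstRemainder` token on the core's run remainders -/

section Token

variable {β : HBeta} {bl β' γ γ₀ : ℝ}

/-- **RESIDUE-SHAPED INSTANCE (drop-in for `…PSFloorWorldBuilt.runConstRemainder_zero_of_boxH`)**: `bₗ ≤ β ≤ β′` on `]0, γ]`, `γ₀ ≤ γ` ⟹ `RunConstRemainder β 0 (max β′ (−bₗ)) γ₀`.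
[cite: Balaban1987RG1, Thm 3 p.264, (1.22) p.264, (5.10) p.293 (bookkeeping)] -/
theorem runConstRemainder_zero_of_boxH' (hlo : BetaLowerH bl γ β) (hhi : BetaUpperH β' γ β) (hγ₀ : γ₀ ≤ γ) :
    RunConstRemainder β (fun _ => 0) (max β' (-bl)) γ₀ := by
  intro n gs hrg hI k hk
  obtain ⟨h1, h2⟩ := runTwoSided_of_boxH hlo hhi hγ₀ n gs hrg hI k hk
  rw [sub_zero, abs_le]
  exact ⟨by linarith [le_max_right β' (-bl)], h2.trans (le_max_left _ _)⟩

/-- DEF-1's token on the SHARP recentred remainder: `RunConstRemainder β (fun _ ↦ (bₗ+β′)∕2) ((β′−bₗ)∕2) γ₀` from the box at any level `γ ≥ γ₀` (the core's `runMidRemainder_of_boxH`, by `rfl`;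
the green K1 v6 adapter `K1RunRowsOfBoxAndPartialSums.runConstRemainder_of_boxBounds` is the `γ₀ = γ` case). [cite: Balaban1987RG1, Thm 3 p.264, (1.22) p.264 (bookkeeping)] -/
theorem runConstRemainder_mid_of_boxH' (hlo : BetaLowerH bl γ β) (hhi : BetaUpperH β' γ β) (hγ₀ : γ₀ ≤ γ) :
    RunConstRemainder β (fun _ => (bl + β') / 2) ((β' - bl) / 2) γ₀ :=
  runMidRemainder_of_boxH hlo hhi hγ₀

/-- DEF-1's token on the abs box: `RunConstRemainder β 0 β′ γ₀` from `−β′ ≤ β ≤ β′` on `]0, γ]`, `γ₀ ≤ γ`. [cite: Balaban1987RG1, Thm 3 p.264, (1.22) p.264 (bookkeeping)] -/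
theorem runConstRemainder_zero_of_absBoxH' (hlo : BetaLowerH (-β') γ β) (hhi : BetaUpperH β' γ β) (hγ₀ : γ₀ ≤ γ) :
    RunConstRemainder β (fun _ => 0) β' γ₀ := by
  intro n gs hrg hI k hk
  rw [sub_zero]
  exact runAbs_of_absBoxH hlo hhi hγ₀ n gs hrg hI k hk

end Token

/-! ## §2  The DAG leaf `FlowStepPrinted` at S- and G-class records, BOX currency (the core's class-free leaf, instantiated) -/

section Classes

variable {F : T4Family} {N : ℕ} [NeZero N]

open Summit.QuantumFields.YangMills.Theorems.K1RunwiseLettersOfBoxH (runCeiling_of_betaUpperH)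

/-- **THE DAG LEAF AT AN S-CLASS RUNG-1 WORLD FROM A β-BOX AND THE NO-SHRINK LETTER**: `D.βfun ≤ w.βup` on the boxes `]0, γ]^(k+1)`, `w.γ ≤ γ₀ ≤ γ`, and the run-wise no-shrink letter
at `w.β₀` on level `γ₀` give `Dag.FlowStepPrinted (leavesP w P)` — the core's class-free `flowStepPrinted_leavesP_of_runLetters` at `β := D.βfun` (`D.curries`, `w.C = D.C`, the class's guarded
(0.20)), ceiling read off the box.  (The CEILING-currency sentence of the residue `…Flow26LettersWorldBuilt.flowStepPrinted_leavesP_of_ceiling_noShrink` is, on green roads, the one-liner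
`flowStepPrinted_leavesP_of_runLetters w (by rw [construction_eq_of_isRecordOfRecord₁₃CSepCoPHS hRS]; exact D.curries) P (rgFlow_of_smallCouplings_of_isRecordOfRecord₁₃CSepCoPHS hRS P) hγ hceil hmul`
— not restated here: the gate's `dedup.landed` indexes the residue module.)  CONDITIONAL; closes nothing. [cite: Balaban1988Convergent, (2.6) p.255; Balaban1989LargeFieldII, Thm 1 + (0.1) pp.355–356; Balaban1987RG1, (0.20) p.256, (1.22) p.264 (bookkeeping)] -/
theorem flowStepPrinted_leavesP_of_betaUpperH_noShrinkS {D : FiniteEpsData F (SU N)} {w : WorldP} (hRS : IsRecordOfRecord₁₃CSepCoPHS F N D w)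
    {γ γ₀ : ℝ} (hγ : w.γ ≤ γ₀) (hle : γ₀ ≤ γ) (hhi : BetaUpperH w.βup γ D.βfun)
    (hmul : ∀ (n : ℕ) (gs : ℕ → ℝ), RGEqH n D.βfun gs → Step.InInterval γ₀ n gs → ∀ m n', m < n' → n' ≤ n → gs m ≤ (1 + w.β₀) * gs n') (P : B12.RunParams) :
    Dag.FlowStepPrinted (leavesP w P) := by
  have hC : w.C = D.C := construction_eq_of_isRecordOfRecord₁₃CSepCoPHS hRS
  have hcur : CurriesHBeta w.C.toB12 D.βfun := by rw [hC]; exact D.curries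
  exact flowStepPrinted_leavesP_of_runLetters w hcur P (rgFlow_of_smallCouplings_of_isRecordOfRecord₁₃CSepCoPHS hRS P) hγ (runCeiling_of_betaUpperH hhi hle) hmul

/-- **THE DAG LEAF AT A `b8`-GENERIC G-CLASS WORLD FROM A β-BOX AND THE NO-SHRINK LETTER** — same, G-class (the residue `…P2CMixedWNoShrinkWorldBuiltG.flowStepPrinted_leavesP_of_ceiling_noShrinkG`'s
ceiling sentence = the core's class-free leaf + `construction_eq_∕rgFlow_of_smallCouplings_of_isRecordOfRecord₁₃CSepCoPHG`, one line at the call site).  CONDITIONAL; closes nothing.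
[cite: Balaban1988Convergent, (2.6) p.255, Cor. 3 (2.50) p.264; Balaban1989LargeFieldII, Thm 1 + (0.1) pp.355–356; Balaban1987RG1, (0.20) p.256, (1.22) p.264 (bookkeeping)] -/
theorem flowStepPrinted_leavesP_of_betaUpperH_noShrinkG {D : FiniteEpsData F (SU N)} {w : WorldP} (hRG : IsRecordOfRecord₁₃CSepCoPHG F N D w)
    {γ γ₀ : ℝ} (hγ : w.γ ≤ γ₀) (hle : γ₀ ≤ γ) (hhi : BetaUpperH w.βup γ D.βfun)
    (hmul : ∀ (n : ℕ) (gs : ℕ → ℝ), RGEqH n D.βfun gs → Step.InInterval γ₀ n gs → ∀ m n', m < n' → n' ≤ n → gs m ≤ (1 + w.β₀) * gs n') (P : B12.RunParams) :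
    Dag.FlowStepPrinted (leavesP w P) := by
  have hC : w.C = D.C := construction_eq_of_isRecordOfRecord₁₃CSepCoPHG hRG
  have hcur : CurriesHBeta w.C.toB12 D.βfun := by rw [hC]; exact D.curries
  exact flowStepPrinted_leavesP_of_runLetters w hcur P (rgFlow_of_smallCouplings_of_isRecordOfRecord₁₃CSepCoPHG hRG P) hγ (runCeiling_of_betaUpperH hhi hle) hmul

/-- The curry letter at any world bound to the datum's construction (`w.C = D.C`): the one extra argument the class-free leaf needs on S-∕G-∕C-class roads. [cite: Balaban1987RG1, §5 p.298 (bookkeeping)] -/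
theorem curriesHBeta_world_of_construction_eq {D : FiniteEpsData F (SU N)} {w : WorldP} (hC : w.C = D.C) : CurriesHBeta w.C.toB12 D.βfun := by
  rw [hC]; exact D.curries

end Classes

end Summit.QuantumFields.YangMills.Theorems.K1RunwiseLettersOfBoxHAtRecord

end
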